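import Summits.CriticalPhenomena.PercolationContinuityZ3.Theorems.PercNearOneGluingNoHeavyLowerTailWorstRelayGluing
import HarnessLib

/-!
# `NoHeavyLowerTail` (stmt-CriticalPhenomena-4575) — HARMONIC MIXING: Kozma–Nitzan's Question 5 coefficients,
# the conjectured determinantal inequality KH₃, and the typed chain  mixing ⇒ pre-FKG (3) ⇒ Conjecture 1 / event gluing ⇒ crux

Support file (prover prim-ineq-gen-8, new-inequality factory; `--supports stmt-CriticalPhenomena-4575`).
No definitions, no named facts, no sorries.

Setting: `μ = prodBernoulli w` on `Fin n`, observer `o`, sink `b`, finite relay set `A`, `U := {o ↔ A} = ⋃_{a∈A} {o ↔ a}`.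
Kozma–Nitzan (arXiv:2401.12397) pre-FKG inequality (3): `μ(U ∩ {o ↔ b}) ≥ min_{a∈A} μ(U ∩ {a ↔ b})`, and their Question 5
(§5.2): are there coefficients `c_a ≥ 0`, `Σ c_a = 1`, NOT depending on `b`, with `μ(U ∩ {o ↔ b}) ≥ Σ_a c_a μ(U ∩ {a ↔ b})`
for all `b`?  Their Theorem 11 (`|A| = 3`): the solution `c` of the linear system `Σ_a c_a μ(U ∩ {a ↔ a'}) = μ(o ↔ a')`
(`a' ∈ A`) has `c ≥ 0` and `Σ c ≥ 1` (used there only for `b ∈ A`).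

**Conjecture KH₃ (this seat; harness request `gen8-KH3`).**  With `M_{aa'} := μ(U ∩ {a ↔ a'})` (`M_{aa} = μ(U)`),
`r_{a'} := μ(o ↔ a')`, `κ := adj(M) r` (so `κ = det M · c`), `S := κ₁ + κ₂ + κ₃`:
  `S · μ(U ∩ {o ↔ b}) ≥ Σ_i κ_i · μ(U ∩ {a_i ↔ b})`  for EVERY vertex `b`
— a homogeneous degree-4 polynomial inequality in the 52 connection-law cells of `(o,a₁,a₂,a₃,b)`, no ordering hypotheses,
symmetric in the relays.  Its `|A| = 2` analogue is exactly KN Theorem 1 (there `c_a = μ(C_o ∩ A = {a}) / μ(|C_o ∩ A| = 1)`,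
`Σ c = 1`).  Evidence (2026-08-19): 0 violations in 4 853 exact (instance, b) pairs (`n ≤ 8`, `b` over all vertices) and in the
harness engine-A screen (412 790 instances); the `|A| = 4, 5` analogues also have 0 violations; KH₃ is NEGATIVE on the wf3lp
pseudo-laws `U13 z*`, `U13 residual-R`, `CM3-B`, `U3 (harris2+all+dt)` and on all three `finePA+tsf+all` vectors, i.e. it is not a
consequence of the fine-poset BHK / threshold-sunflower / Harris / Reimer / MIX / decision-tree product cone at any degree.

**STATUS UPDATE (same day): KH₃ is FALSE as an all-laws inequality.**  Exact witness (found by the seat prim-ineq-gen-7 for the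
same functional, confirmed independently): six vertices `o, a₁, a₂, a₃, b, x`, edges `o–a₁ 11/20` (`a₁` a dead end),
`a₂–b 2/9`, `a₃–b 1/2`, `a₂–x 7/25`, `a₃–x 9/50`, `o–x ε`: `PHI/det M = −1.25·10⁻⁷` at `ε = 1/4000`, `−1.7·10⁻⁵` at `ε = 1/10`;
the largest violation found in this family is `(Σ κ_i R_i)/(S·L) ≈ 1.0085`.  The failure lives in a thin "dead-end relay + weakly
probing observer" corner (it disappears once `a₁` has an edge of weight `≥ 0.05` to `b`, or `ε ≥ 0.05`): to first order in `ε` KH₃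
reduces there to the false 4-point environment inequality `(1 − m²) τ(x,b) ≥ τ(a₂,b)(τ(x,a₂) − m τ(x,a₃)) + τ(a₃,b)(τ(x,a₃) − m τ(x,a₂))`,
`m = τ(a₂,a₃)`.  All uniform-weight censuses (exhaustive `n = 6` at `p = ½, ⅔`: 2 × 11.8 M tests; 30 M random `n = 7` tests) satisfy
KH₃, Kozma–Nitzan's Question 5 is NOT refuted on the witness (other `b`-independent coefficients remain feasible), (3) holds there,
and Theorem 11 (`c ≥ 0`, `Σc ≥ 1`) is unaffected.  The theorems of this file are generic (they take the mixing inequality as a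
hypothesis) and remain valid; only the conjectured instantiation `κ = adj(M) r` for ALL laws is withdrawn — as a row it can only be used
under regime hypotheses (e.g. near-one: every relay joined to the sink with probability `≥ 1 − δ₀`).

What is PROVED here (bookkeeping for the chain):
* `preFKG_of_mixing` — any nonnegative, not identically zero coefficient vector `c` with
  `Σ_a c_a μ(U ∩ {a↔b}) ≤ (Σ_a c_a) μ(U ∩ {o↔b})` yields (3) at some relay (pigeonhole); `preFKG3_of_harmonicCoefficients` is the
  `|A| = 3` instance in the shape of KH₃ + KN Thm 11 (`κ_i ≥ 0`, `Σ κ_i > 0`).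
* `eventGluing_of_preFKG`, `condGluing_of_preFKG` — (3) for all relay sets ⇒ event gluing with constant 1, indeed the sharper
  conditional form `μ({o↮b} ∩ U) ≤ μ(U) · max_a μ(a ↮ b)` (Harris); hence `additiveGluing_of_preFKG` (stmt-4576) and
  `noHeavyLowerTail_of_preFKG` (stmt-4575) by the landed glue, and `kozmaNitzan_conjecture1_of_preFKG` (calibration).
So: KH_k ∧ (nonnegativity of the harmonic coefficients, or just `Σ_a κ_a μ(U∩{a↔b}) ≥ S·min_a μ(U∩{a↔b})`) for all `k` ⇒ crux.
-/

noncomputable section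

namespace Summit.CriticalPhenomena.PercolationContinuityZ3.Theorems

open MeasureTheory Set Literature.Probability.LatticeModels Literature.Probability.Percolation
open Summit.CriticalPhenomena.PercolationContinuityZ3.Theses.PercNearOneGluing
open scoped Classical BigOperators

namespace HarmonicMixing

variable {n : ℕ}

/-- **Mixing ⇒ pre-FKG (3) at some relay.**  If nonnegative coefficients `c`, not all zero on `A`, satisfy
`Σ_a c_a μ(U ∩ {a ↔ b}) ≤ (Σ_a c_a) · μ(U ∩ {o ↔ b})`, then some relay `a ∈ A` has `μ(U ∩ {a ↔ b}) ≤ μ(U ∩ {o ↔ b})`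
(Kozma–Nitzan's (3) at `a`).  Pigeonhole. [this file] -/
theorem preFKG_of_mixing (w : Sym2 (Fin n) → unitInterval) (A : Finset (Fin n)) (o b : Fin n) (c : Fin n → ℝ)
    (hc : ∀ a ∈ A, 0 ≤ c a) (hpos : 0 < ∑ a ∈ A, c a)
    (hmix : ∑ a ∈ A, c a * (prodBernoulli w).real ((⋃ x ∈ A, (openConn o x : Set (BondConfig (Fin n)))) ∩ openConn a b) ≤
      (∑ a ∈ A, c a) * (prodBernoulli w).real ((⋃ x ∈ A, (openConn o x : Set (BondConfig (Fin n)))) ∩ openConn o b)) :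
    ∃ a ∈ A, (prodBernoulli w).real ((⋃ x ∈ A, (openConn o x : Set (BondConfig (Fin n)))) ∩ openConn a b) ≤
      (prodBernoulli w).real ((⋃ x ∈ A, (openConn o x : Set (BondConfig (Fin n)))) ∩ openConn o b) := by
  set μ := prodBernoulli w with hμ
  set U : Set (BondConfig (Fin n)) := ⋃ x ∈ A, (openConn o x : Set (BondConfig (Fin n))) with hU
  set L : ℝ := μ.real (U ∩ openConn o b) with hL
  by_contra h
  push Not at h
  -- every relay has `L < μ(U ∩ {a↔b})`; some relay has `c a > 0`
  obtain ⟨a₀, ha₀, hca₀⟩ : ∃ a ∈ A, (0 : ℝ) < c a := by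
    have h0 : ∑ a ∈ A, (0 : ℝ) < ∑ a ∈ A, c a := by rw [Finset.sum_const_zero]; exact hpos
    exact Finset.exists_lt_of_sum_lt h0
  have hlt : ∑ a ∈ A, c a * L < ∑ a ∈ A, c a * μ.real (U ∩ openConn a b) := by
    apply Finset.sum_lt_sum
    · intro a ha
      exact mul_le_mul_of_nonneg_left (le_of_lt (h a ha)) (hc a ha)
    · exact ⟨a₀, ha₀, mul_lt_mul_of_pos_left (h a₀ ha₀) hca₀⟩
  rw [← Finset.sum_mul] at hlt
  linarith

/-- **The `|A| = 3` instance in the shape of KH₃ + KN Theorem 11.**  For relays `a₁, a₂, a₃` and reals `κ₁, κ₂, κ₃ ≥ 0` with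
`κ₁ + κ₂ + κ₃ > 0` (KN Thm 11: `κ = adj(M) r = det M · c` has this property) and the harmonic-mixing inequality
`κ₁ μ(U∩{a₁↔b}) + κ₂ μ(U∩{a₂↔b}) + κ₃ μ(U∩{a₃↔b}) ≤ (κ₁+κ₂+κ₃) μ(U∩{o↔b})` (conjecture KH₃ when `κ = adj(M) r`),
Kozma–Nitzan's pre-FKG inequality (3) holds at one of the three relays. [this file] -/
theorem preFKG3_of_harmonicCoefficients (w : Sym2 (Fin n) → unitInterval) (o b a₁ a₂ a₃ : Fin n) (κ₁ κ₂ κ₃ : ℝ)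
    (h₁ : 0 ≤ κ₁) (h₂ : 0 ≤ κ₂) (h₃ : 0 ≤ κ₃) (hS : 0 < κ₁ + κ₂ + κ₃)
    (hKH : κ₁ * (prodBernoulli w).real ((⋃ x ∈ ({a₁, a₂, a₃} : Finset (Fin n)), (openConn o x : Set (BondConfig (Fin n)))) ∩ openConn a₁ b) +
        κ₂ * (prodBernoulli w).real ((⋃ x ∈ ({a₁, a₂, a₃} : Finset (Fin n)), (openConn o x : Set (BondConfig (Fin n)))) ∩ openConn a₂ b) +
        κ₃ * (prodBernoulli w).real ((⋃ x ∈ ({a₁, a₂, a₃} : Finset (Fin n)), (openConn o x : Set (BondConfig (Fin n)))) ∩ openConn a₃ b) ≤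
      (κ₁ + κ₂ + κ₃) *
        (prodBernoulli w).real ((⋃ x ∈ ({a₁, a₂, a₃} : Finset (Fin n)), (openConn o x : Set (BondConfig (Fin n)))) ∩ openConn o b)) :
    ∃ a ∈ ({a₁, a₂, a₃} : Finset (Fin n)),
      (prodBernoulli w).real ((⋃ x ∈ ({a₁, a₂, a₃} : Finset (Fin n)), (openConn o x : Set (BondConfig (Fin n)))) ∩ openConn a b) ≤
        (prodBernoulli w).real ((⋃ x ∈ ({a₁, a₂, a₃} : Finset (Fin n)), (openConn o x : Set (BondConfig (Fin n)))) ∩ openConn o b) := by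
  set μ := prodBernoulli w with hμ
  set U : Set (BondConfig (Fin n)) := ⋃ x ∈ ({a₁, a₂, a₃} : Finset (Fin n)), (openConn o x : Set (BondConfig (Fin n))) with hU
  by_contra h
  push Not at h
  have e₁ := h a₁ (by simp)
  have e₂ := h a₂ (by simp)
  have e₃ := h a₃ (by simp)
  set L : ℝ := μ.real (U ∩ openConn o b) with hL
  set R₁ : ℝ := μ.real (U ∩ openConn a₁ b) with hR₁
  set R₂ : ℝ := μ.real (U ∩ openConn a₂ b) with hR₂
  set R₃ : ℝ := μ.real (U ∩ openConn a₃ b) with hR₃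
  set δ : ℝ := min (R₁ - L) (min (R₂ - L) (R₃ - L)) with hδ
  have hδpos : 0 < δ := lt_min (by linarith) (lt_min (by linarith) (by linarith))
  have d₁ : δ ≤ R₁ - L := min_le_left _ _
  have d₂ : δ ≤ R₂ - L := le_trans (min_le_right _ _) (min_le_left _ _)
  have d₃ : δ ≤ R₃ - L := le_trans (min_le_right _ _) (min_le_right _ _)
  have p₁ : κ₁ * δ ≤ κ₁ * (R₁ - L) := mul_le_mul_of_nonneg_left d₁ h₁
  have p₂ : κ₂ * δ ≤ κ₂ * (R₂ - L) := mul_le_mul_of_nonneg_left d₂ h₂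
  have p₃ : κ₃ * δ ≤ κ₃ * (R₃ - L) := mul_le_mul_of_nonneg_left d₃ h₃
  have hp : 0 < (κ₁ + κ₂ + κ₃) * δ := mul_pos hS hδpos
  nlinarith

/-- **Pre-FKG (3) for all relay sets ⇒ CONDITIONAL event gluing**: `μ({o ↮ b} ∩ U) ≤ μ(U) · s` whenever `μ(a ↮ b) ≤ s` on `A`
(`U = {o ↔ A}`).  From (3) at the relay `a`: `μ({o↮b} ∩ U) = μ(U) − μ(U ∩ {o↔b}) ≤ μ(U) − μ(U ∩ {a↔b}) = μ(U ∩ {a↮b})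
≤ μ(U) μ(a ↮ b)` (Harris, increasing × decreasing). [this file] -/
theorem condGluing_of_preFKG
    (hP3 : ∀ (n : ℕ) (w : Sym2 (Fin n) → unitInterval) (A : Finset (Fin n)) (o b : Fin n), A.Nonempty →
      ∃ a ∈ A, (prodBernoulli w).real ((⋃ x ∈ A, (openConn o x : Set (BondConfig (Fin n)))) ∩ openConn a b) ≤
        (prodBernoulli w).real ((⋃ x ∈ A, (openConn o x : Set (BondConfig (Fin n)))) ∩ openConn o b)) :
    ∀ (n : ℕ) (w : Sym2 (Fin n) → unitInterval) (A : Finset (Fin n)) (o b : Fin n) (s : ℝ), 0 ≤ s →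
      (∀ a ∈ A, (prodBernoulli w).real (openConn a b : Set (BondConfig (Fin n)))ᶜ ≤ s) →
      (prodBernoulli w).real ((openConn o b : Set (BondConfig (Fin n)))ᶜ ∩ ⋃ a ∈ A, openConn o a) ≤
        (prodBernoulli w).real (⋃ a ∈ A, (openConn o a : Set (BondConfig (Fin n)))) * s := by
  intro n w A o b s hs hcut
  set μ := prodBernoulli w with hμ
  set U : Set (BondConfig (Fin n)) := ⋃ x ∈ A, (openConn o x : Set (BondConfig (Fin n))) with hU
  rcases A.eq_empty_or_nonempty with hAe | hAne
  · have hU0 : U = ∅ := by rw [hU, hAe]; simp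
    rw [Set.inter_comm, hU0, Set.empty_inter, measureReal_empty, zero_mul]
  obtain ⟨a, ha, h3⟩ := hP3 n w A o b hAne
  have hso := OwnDisconnection.split w U (openConn o b)
  have hsa := OwnDisconnection.split w U (openConn a b)
  have hUup : IsUpperSet U := isUpperSet_iUnion₂ fun x _ => isUpperSet_openConn o x
  have hH : μ.real (U ∩ (openConn a b : Set (BondConfig (Fin n)))ᶜ) ≤
      μ.real U * μ.real (openConn a b : Set (BondConfig (Fin n)))ᶜ :=
    prodBernoulli_harris_upper_lower_via_fibres w hUup (isUpperSet_openConn a b).compl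
  have hUn : 0 ≤ μ.real U := measureReal_nonneg
  rw [Set.inter_comm]
  calc μ.real (U ∩ (openConn o b : Set (BondConfig (Fin n)))ᶜ)
      ≤ μ.real (U ∩ (openConn a b : Set (BondConfig (Fin n)))ᶜ) := by linarith
    _ ≤ μ.real U * μ.real (openConn a b : Set (BondConfig (Fin n)))ᶜ := hH
    _ ≤ μ.real U * s := mul_le_mul_of_nonneg_left (hcut a ha) hUn

/-- **Pre-FKG (3) for all relay sets ⇒ event gluing with constant 1**:
`μ({o ↮ b} ∩ {o ↔ A}) ≤ max_{a∈A} μ(a ↮ b)`. [this file] -/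
theorem eventGluing_of_preFKG
    (hP3 : ∀ (n : ℕ) (w : Sym2 (Fin n) → unitInterval) (A : Finset (Fin n)) (o b : Fin n), A.Nonempty →
      ∃ a ∈ A, (prodBernoulli w).real ((⋃ x ∈ A, (openConn o x : Set (BondConfig (Fin n)))) ∩ openConn a b) ≤
        (prodBernoulli w).real ((⋃ x ∈ A, (openConn o x : Set (BondConfig (Fin n)))) ∩ openConn o b)) :
    ∀ (n : ℕ) (w : Sym2 (Fin n) → unitInterval) (A : Finset (Fin n)) (o c : Fin n) (s : ℝ), 0 ≤ s →
      (∀ a ∈ A, (prodBernoulli w).real (openConn a c : Set (BondConfig (Fin n)))ᶜ ≤ s) →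
      (prodBernoulli w).real ((openConn o c : Set (BondConfig (Fin n)))ᶜ ∩ ⋃ a ∈ A, openConn o a) ≤ s := by
  intro n w A o c s hs hcut
  have h := condGluing_of_preFKG hP3 n w A o c s hs hcut
  have hU1 : (prodBernoulli w).real (⋃ a ∈ A, (openConn o a : Set (BondConfig (Fin n)))) ≤ 1 := by
    haveI : IsProbabilityMeasure (prodBernoulli w) := inferInstance
    exact measureReal_le_one
  calc (prodBernoulli w).real ((openConn o c : Set (BondConfig (Fin n)))ᶜ ∩ ⋃ a ∈ A, openConn o a)
      ≤ (prodBernoulli w).real (⋃ a ∈ A, (openConn o a : Set (BondConfig (Fin n)))) * s := h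
    _ ≤ 1 * s := mul_le_mul_of_nonneg_right hU1 hs
    _ = s := one_mul s

/-- **Pre-FKG (3) for all relay sets ⇒ `AdditiveGluing`** (stmt-CriticalPhenomena-4576). [this file] -/
theorem additiveGluing_of_preFKG
    (hP3 : ∀ (n : ℕ) (w : Sym2 (Fin n) → unitInterval) (A : Finset (Fin n)) (o b : Fin n), A.Nonempty →
      ∃ a ∈ A, (prodBernoulli w).real ((⋃ x ∈ A, (openConn o x : Set (BondConfig (Fin n)))) ∩ openConn a b) ≤
        (prodBernoulli w).real ((⋃ x ∈ A, (openConn o x : Set (BondConfig (Fin n)))) ∩ openConn o b)) :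
    Summit.CriticalPhenomena.PercolationContinuityZ3.Theses.PercNearOneGluing.AdditiveGluing :=
  additiveGluing_of_eventGluing (eventGluing_of_preFKG hP3)

/-- **Pre-FKG (3) for all relay sets ⇒ `NoHeavyLowerTail`** (stmt-CriticalPhenomena-4575), through the landed glue
`event gluing ⇒ AdditiveGluing ⇒ NearOneGluing ⇒ residual ⇒ crux`.  In particular KH_k (harmonic mixing with the
Kozma–Nitzan linear-system coefficients) together with nonnegativity of those coefficients, for every `k`, would close the crux.
[this file] -/
theorem noHeavyLowerTail_of_preFKG
    (hP3 : ∀ (n : ℕ) (w : Sym2 (Fin n) → unitInterval) (A : Finset (Fin n)) (o b : Fin n), A.Nonempty →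
      ∃ a ∈ A, (prodBernoulli w).real ((⋃ x ∈ A, (openConn o x : Set (BondConfig (Fin n)))) ∩ openConn a b) ≤
        (prodBernoulli w).real ((⋃ x ∈ A, (openConn o x : Set (BondConfig (Fin n)))) ∩ openConn o b)) :
    Summit.CriticalPhenomena.PercolationContinuityZ3.Theses.PercNearOneGluing.NoHeavyLowerTail :=
  noHeavyLowerTail_of_eventGluing (eventGluing_of_preFKG hP3)

/-- **Calibration: pre-FKG (3) for all relay sets ⇒ Kozma–Nitzan Conjecture 1 (post-FKG)** in the tree's form
`(∀ a ∈ A, t ≤ μ(a ↔ b)) → μ(o ↔ A) · t ≤ μ(o ↔ b)`: from (3) at the relay `a` and Harris (increasing × increasing)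
`μ(U) μ(a ↔ b) ≤ μ(U ∩ {a ↔ b}) ≤ μ(U ∩ {o ↔ b}) ≤ μ(o ↔ b)`. [cite: KozmaNitzan2024, Conjecture 1 (p. 3) and eq. (3)] -/
theorem kozmaNitzan_conjecture1_of_preFKG
    (hP3 : ∀ (n : ℕ) (w : Sym2 (Fin n) → unitInterval) (A : Finset (Fin n)) (o b : Fin n), A.Nonempty →
      ∃ a ∈ A, (prodBernoulli w).real ((⋃ x ∈ A, (openConn o x : Set (BondConfig (Fin n)))) ∩ openConn a b) ≤
        (prodBernoulli w).real ((⋃ x ∈ A, (openConn o x : Set (BondConfig (Fin n)))) ∩ openConn o b)) :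
    ∀ (n : ℕ) (w : Sym2 (Fin n) → unitInterval) (A : Finset (Fin n)) (o b : Fin n) (t : ℝ),
      (∀ a ∈ A, t ≤ (prodBernoulli w).real (openConn a b)) →
        (prodBernoulli w).real (⋃ a ∈ A, openConn o a) * t ≤ (prodBernoulli w).real (openConn o b) := by
  intro n w A o b t ht
  set μ := prodBernoulli w with hμ
  set U : Set (BondConfig (Fin n)) := ⋃ x ∈ A, (openConn o x : Set (BondConfig (Fin n))) with hU
  rcases A.eq_empty_or_nonempty with hAe | hAne
  · have hU0 : U = ∅ := by rw [hU, hAe]; simp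
    rw [hU0, measureReal_empty, zero_mul]; exact measureReal_nonneg
  obtain ⟨a, ha, h3⟩ := hP3 n w A o b hAne
  have hUup : IsUpperSet U := isUpperSet_iUnion₂ fun x _ => isUpperSet_openConn o x
  have hH : μ.real U * μ.real (openConn a b : Set (BondConfig (Fin n))) ≤ μ.real (U ∩ openConn a b) :=
    prodBernoulli_harris_via_fibres w hUup (isUpperSet_openConn a b)
  have hmono : μ.real (U ∩ openConn o b) ≤ μ.real (openConn o b : Set (BondConfig (Fin n))) :=
    measureReal_mono Set.inter_subset_right
  have hUn : 0 ≤ μ.real U := measureReal_nonneg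
  calc μ.real U * t ≤ μ.real U * μ.real (openConn a b : Set (BondConfig (Fin n))) :=
        mul_le_mul_of_nonneg_left (ht a ha) hUn
    _ ≤ μ.real (U ∩ openConn a b) := hH
    _ ≤ μ.real (U ∩ openConn o b) := h3
    _ ≤ μ.real (openConn o b : Set (BondConfig (Fin n))) := hmono

end HarmonicMixing

end Summit.CriticalPhenomena.PercolationContinuityZ3.Theorems

end
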